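import Summits.BirchSwinnertonDyer.Rank1Residual.Partition.AnticyclotomicControlPublished
import Literature.NumberTheory.NumberFields.PadicEmbeddingValuation
import HarnessLib

/-!
# The prime of `K` INDUCED by an embedding `ι : K ↪ ℚ_p`, and CGLS Thm. 5.1.1's datum discharged
# from an embedding alone (non-vacuity of the `(ι, v, v̄)` binder of `thm511_anticyclotomicControl`)

HONEST FRAMING (cell `b2b-bsdres`, run/shared/lean/b2b/bsd-rank1-residual/, verbatim in every
file): the goal of the cell is to DELETE the COMBINATION-SHAPED residual classes of the
Birch–Swinnerton-Dyer formula for ALL analytic-rank `≤ 1` elliptic curves over `ℚ` from PUBLISHED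
theorems only, so that the remainder becomes exactly the CONSTRUCTION-SHAPED classes, which are
TYPED, not attempted; this is not "finishing BSD". Unit `b2b-bsdres-lit-cgls` (off-peak literature
typer), session 5, sized ask S11 of `HOME/b2b-bsdres-lit-cgls/CGLS-GV-TYPING.md` §12.5. A DEFINITION
with a body (plumbing: an ideal of `𝓞 K`) and THEOREMS; no named fact; no `sorry`; nothing booked; no
label moved.

## What and why

The named fact `CastellaGrossiLeeSkinner2022.thm511_anticyclotomicControl` (CGLS 2022 Thm. 5.1.1,
p246021) follows the paper's §2 setting word for word: "we fix … an embedding `ι_p : ℚ̄ ↪ ℚ̄_p`, and let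
`K` be an imaginary quadratic field in which `p = v v̄` splits, with `v` the prime of `K` above `p`
INDUCED BY `ι_p`" — binders `(ι : K →+* ℚ_[p]) (v vbar : HeightOneSpectrum (𝓞 K))`,
`hv : ∀ x, x ∈ v ↔ ‖ι x‖ < 1`, `hvbar : p ∈ vbar`, `hne : vbar ≠ v`. This file shows those binders are
dischargeable from ANY embedding `ι` (so the fact, and the adapter
`X11b.indexLowerBoundAt_of_heegner_of_thm511`, are demanded at EXISTING data, not vacuously):

* `inducedPlace ι : HeightOneSpectrum (𝓞 K)` — the prime `{x ∈ 𝓞 K : ‖ι x‖_p < 1}` (the contraction of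
  `pℤ_p` along the tree's `toPadicInt ι : 𝓞 K →+* ℤ_p`, `Literature/NumberTheory/NumberFields/
  PadicEmbeddingValuation.lean` — prime, and nonzero as it contains `p`); `mem_inducedPlace_iff` (= the binder `hv`, by `Iff.rfl`), `natCast_mem_inducedPlace`.
* `mem_primesOver_of_natCast_mem` — a prime of `𝓞 K` containing `p` lies over `pℤ`;
  `exists_other_prime` — under (spl) `SatisfiesHeegnerHypothesis p K` (exactly two primes above `p`)
  there is `vbar ∋ p`, `vbar ≠ v` (the binders `hvbar`, `hne`).
* `indexLowerBoundAt_of_heegner_of_thm511_of_embedding` — STEP L at a classical Heegner datum from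
  typed (IMC≥∘BDP)ᵍ at `(κ, γ, vbar, ι)` + the PUBLISHED (CTL)ᵍ, with `v := inducedPlace ι`;
  `exists_controlOnTreeGoodAt_of_thm511` — for every embedding `ι` and every anticyclotomic `(κ, γ)`
  there IS a strict prime `vbar` at which the cell's control link holds (published), at every point of
  infinite order, given the hypotheses of Thm. 5.1.1.

References: [CastellaGrossiLeeSkinner2022] §2 (arXiv:2008.02571v2 TeX L479), Thm. 5.1.1;
[Neukirch1999] II (4.8)/(8.1) (primes above `p` ↔ embeddings into `ℚ̄_p`) — background only;
HOME/b2b-bsdres-lit-cgls/CGLS-GV-TYPING.md §12.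
-/

noncomputable section

open scoped Classical

open WeierstrassCurve NumberField IsDedekindDomain Literature.NumberTheory.EllipticCurves
  Literature.NumberTheory.EllipticCurves.ModularForms
  Literature.NumberTheory.EllipticCurves.Rank1Residual
  Literature.NumberTheory.EllipticCurves.CastellaGrossiLeeSkinner2022

namespace Summit.BirchSwinnertonDyer.Rank1Residual.X11b

/-! ### §1 The prime induced by an embedding -/

section Place

open Literature.NumberTheory.NumberFields

variable {K : Type} [Field K] [NumberField K] {p : ℕ} [hp : Fact p.Prime]

omit [NumberField K] in
/-- Coercion bookkeeping: `ι x = (ι ∘ algebraMap) x` for `x : 𝓞 K`. [folklore] -/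
theorem coe_ringOfIntegers_apply (ι : K →+* ℚ_[p]) (x : 𝓞 K) :
    ι (x : K) = (ι.comp (algebraMap (𝓞 K) K)) x := rfl

/-- The ideal of `𝓞 K` INDUCED by an embedding `ι : K ↪ ℚ_p`: the contraction `ι⁻¹(pℤ_p) ∩ 𝓞 K` of the
maximal ideal of `ℤ_p` along the tree's `toPadicInt ι : 𝓞 K →+* ℤ_p` (`ι(𝓞 K) ⊆ ℤ_p`,
`Literature.NumberTheory.NumberFields.norm_embedding_le_one`), i.e. `{x : ‖ι x‖_p < 1}`
(`mem_inducedIdeal_iff`). [cite: CastellaGrossiLeeSkinner2022, §2 (arXiv v2 TeX L479: "`v` the prime of `K` above `p` induced by `ι_p`")] -/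
def inducedIdeal (ι : K →+* ℚ_[p]) : Ideal (𝓞 K) :=
  Ideal.comap (toPadicInt ι) (IsLocalRing.maximalIdeal ℤ_[p])

omit [NumberField K] in
/-- Membership in the induced ideal: `x ∈ ι⁻¹(pℤ_p) ⟺ ‖ι x‖_p < 1` (an element of `ℤ_p` is a non-unit
iff its norm is `< 1`). [folklore] -/
theorem mem_inducedIdeal_iff (ι : K →+* ℚ_[p]) (x : 𝓞 K) :
    x ∈ inducedIdeal ι ↔ ‖ι (x : K)‖ < 1 := by
  rw [inducedIdeal, Ideal.mem_comap, IsLocalRing.mem_maximalIdeal, mem_nonunits_iff,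
    PadicInt.isUnit_iff]
  have hle : ‖ι (x : K)‖ ≤ 1 := norm_embedding_le_one ι x
  change ¬ ‖ι (x : K)‖ = 1 ↔ _
  exact ⟨fun h ↦ lt_of_le_of_ne hle h, fun h ↦ h.ne⟩

omit [NumberField K] in
/-- `p` lies in the induced ideal: `‖p‖_p = p⁻¹ < 1`. [folklore] -/
theorem natCast_mem_inducedIdeal (ι : K →+* ℚ_[p]) : ((p : ℕ) : 𝓞 K) ∈ inducedIdeal ι := by
  rw [mem_inducedIdeal_iff, coe_ringOfIntegers_apply, map_natCast]
  exact Padic.norm_p_lt_one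

omit [NumberField K] in
/-- The induced ideal is prime (contraction of a prime ideal). [folklore] -/
theorem inducedIdeal_isPrime (ι : K →+* ℚ_[p]) : (inducedIdeal ι).IsPrime :=
  Ideal.comap_isPrime _ _

/-- The induced ideal is nonzero (it contains `p ≠ 0`; `𝓞 K` has characteristic `0`). [folklore] -/
theorem inducedIdeal_ne_bot (ι : K →+* ℚ_[p]) : inducedIdeal ι ≠ ⊥ := by
  intro h
  have hm := natCast_mem_inducedIdeal (K := K) ι
  rw [h, Ideal.mem_bot] at hm
  exact (Nat.cast_ne_zero.mpr hp.out.ne_zero) hm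

/-- **The prime `v` of `K` above `p` INDUCED by the embedding `ι : K ↪ ℚ_p`** (CGLS 2022 §2: "with `v`
the prime of `K` above `p` induced by `ι_p`"), as a `HeightOneSpectrum` element of `𝓞 K`.
[cite: CastellaGrossiLeeSkinner2022, §2 (arXiv v2 TeX L479)] -/
def inducedPlace (ι : K →+* ℚ_[p]) : HeightOneSpectrum (𝓞 K) :=
  ⟨inducedIdeal ι, inducedIdeal_isPrime ι, inducedIdeal_ne_bot ι⟩

/-- **The binder `hv` of `thm511_anticyclotomicControl` at `v := inducedPlace ι`**: `x ∈ v ⟺ ‖ι x‖ < 1`.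
[cite: CastellaGrossiLeeSkinner2022, §2 (arXiv v2 TeX L479) and Thm. 5.1.1] -/
theorem mem_inducedPlace_iff (ι : K →+* ℚ_[p]) (x : 𝓞 K) :
    x ∈ (inducedPlace ι).asIdeal ↔ ‖ι (x : K)‖ < 1 :=
  mem_inducedIdeal_iff ι x

/-- The induced prime lies above `p`. [cite: CastellaGrossiLeeSkinner2022, §2 (arXiv v2 TeX L479)] -/
theorem natCast_mem_inducedPlace (ι : K →+* ℚ_[p]) :
    ((p : ℕ) : 𝓞 K) ∈ (inducedPlace ι).asIdeal := natCast_mem_inducedIdeal ι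

omit [NumberField K] in
/-- A prime of `𝓞 K` containing the rational prime `p` lies over `pℤ` (`pℤ` is maximal and
contained in the contraction). [folklore] -/
theorem mem_primesOver_of_natCast_mem (v : HeightOneSpectrum (𝓞 K))
    (hv : ((p : ℕ) : 𝓞 K) ∈ v.asIdeal) :
    v.asIdeal ∈ (Ideal.span {(p : ℤ)}).primesOver (𝓞 K) := by
  haveI := v.isPrime
  refine ⟨v.isPrime, ⟨?_⟩⟩
  have hp0 : (p : ℤ) ≠ 0 := by exact_mod_cast hp.out.ne_zero
  have hmax : (Ideal.span {(p : ℤ)}).IsMaximal :=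
    ((Ideal.span_singleton_prime hp0).mpr (Nat.prime_iff_prime_int.mp hp.out)).isMaximal
      (by rw [Ne, Ideal.span_singleton_eq_bot]; exact hp0)
  refine hmax.eq_of_le ?_ ?_
  · exact Ideal.IsPrime.ne_top inferInstance
  · rw [Ideal.span_le, Set.singleton_subset_iff, SetLike.mem_coe, Ideal.under_def, Ideal.mem_comap,
      map_natCast]
    exact hv

/-- **The binders `hvbar`, `hne`**: with `p` split in `K` (`SatisfiesHeegnerHypothesis p K`: exactly
two primes of `𝓞 K` above `p` — "`p = v v̄` splits", CGLS §2) every prime `v ∋ p` has a partner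
`vbar ∋ p`, `vbar ≠ v`. [cite: CastellaGrossiLeeSkinner2022, §2 (arXiv v2 TeX L479: "`p = v v̄` splits")] -/
theorem exists_other_prime (hH : Literature.NumberTheory.EllipticCurves.SatisfiesHeegnerHypothesis p K)
    (v : HeightOneSpectrum (𝓞 K)) (hv : ((p : ℕ) : 𝓞 K) ∈ v.asIdeal) :
    ∃ vbar : HeightOneSpectrum (𝓞 K), ((p : ℕ) : 𝓞 K) ∈ vbar.asIdeal ∧ vbar ≠ v := by
  have h2 := hH p hp.out (dvd_refl p)
  obtain ⟨P, Q, hPQ, hset⟩ := Set.ncard_eq_two.mp h2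
  have hvmem := mem_primesOver_of_natCast_mem v hv
  rw [hset] at hvmem
  -- pick the element of {P, Q} different from v.asIdeal
  have key : ∀ R ∈ ({P, Q} : Set (Ideal (𝓞 K))), R ≠ v.asIdeal →
      ∃ vbar : HeightOneSpectrum (𝓞 K), ((p : ℕ) : 𝓞 K) ∈ vbar.asIdeal ∧ vbar ≠ v := by
    intro R hR hne
    have hR' : R ∈ (Ideal.span {(p : ℤ)}).primesOver (𝓞 K) := by rw [hset]; exact hR
    obtain ⟨hRprime, hRover⟩ := hR'
    have hpR : ((p : ℕ) : 𝓞 K) ∈ R := by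
      have : (algebraMap ℤ (𝓞 K)) (p : ℤ) ∈ R := by
        rw [← Ideal.mem_comap, ← Ideal.under_def, ← hRover.over]
        exact Ideal.subset_span rfl
      rwa [map_natCast] at this
    have hRne : R ≠ ⊥ := by
      intro hb
      rw [hb, Ideal.mem_bot] at hpR
      exact (Nat.cast_ne_zero.mpr hp.out.ne_zero) hpR
    refine ⟨⟨R, hRprime, hRne⟩, hpR, fun h ↦ hne ?_⟩
    rw [← h]
  rcases hvmem with h | h
  · exact key Q (by simp) (by rw [h]; exact hPQ.symm)
  · exact key P (by simp) (by rw [h]; exact hPQ)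


end Place

/-! ### §2 CGLS Thm. 5.1.1's datum from an embedding alone -/

section Datum

variable (W : WeierstrassCurve ℚ) [W.IsElliptic] [W.IsGloballyMinimal] (p : ℕ) [Fact p.Prime]
  (N : ℕ) [NeZero N] (K : Type) [Field K] [NumberField K]
  (Dt : ModularParametrizationData W N) (H : HeegnerDatum N (NumberField.discr K)) (ιC : K →+* ℂ)
  (P : (W.baseChange K).toAffine.Point)

/-- **STEP L at a classical Heegner datum from an EMBEDDING `ι : K ↪ ℚ_p` and a strict prime
`vbar ≠ inducedPlace ι`**: `X11b.indexLowerBoundAt_of_heegner_of_thm511` with its binder `hv`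
discharged by `v := inducedPlace ι` (`mem_inducedPlace_iff`). Inputs: typed (IMC≥∘BDP)ᵍ `hIW` at
`(κ, γ, vbar, ι)`; published `h511`, `hGZ`, `hKo`, `hmod`, `hGZK`.
[cite: CastellaGrossiLeeSkinner2022, Thm. 5.1.1 and §2] [cite: JetchevSkinnerWan2017, §7.4.1 (eq:shalowerK-1) (arXiv:1512.06894 p. 30)] -/
theorem indexLowerBoundAt_of_heegner_of_thm511_of_embedding (h511 : thm511_anticyclotomicControl)
    (hGZ : gross_zagier N W K) (hKo : kolyvagin N W K) (hmod : hasEntireLFunction_rat)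
    (hGZK : rank_eq_analyticRank_of_analyticRank_le_one)
    (hp : 2 < p) (hord : GoodOrd W p) (hna : ¬ (p : ℤ) ∣ W.frobeniusTrace p - 1)
    (hr : W.analyticRank = 1) (hN : W.conductorNorm ℤ = N) (hK : IsImaginaryQuadratic K)
    (hHN : SatisfiesHeegnerHypothesis N K) (hHp : SatisfiesHeegnerHypothesis p K)
    (hLt : (W.quadraticTwist (NumberField.discr K : ℚ)).entireLFunction 1 ≠ 0)
    (hP : WeierstrassCurve.Affine.Point.map ιC.toRatAlgHom P = heegnerPointComplex Dt H)
    {κ : ZpExtension K p} (hκ : κ.IsAnticyclotomic) {γ : Field.absoluteGaloisGroup K}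
    [Fact (κ.IsTopGenerator γ)] (ι : K →+* ℚ_[p]) (vbar : HeightOneSpectrum (𝓞 K))
    (hvbar : ((p : ℕ) : 𝓞 K) ∈ vbar.asIdeal) (hne : vbar ≠ inducedPlace ι)
    (hIW : IMCLowerWaldspurgerOnTreeGoodAt p κ vbar γ ι P) :
    IndexLowerBoundAt W p K P :=
  indexLowerBoundAt_of_heegner_of_thm511 W p N K Dt H ιC P h511 hGZ hKo hmod hGZK hp hord hna hr hN hK
    hHN hHp hLt hP hκ ι (inducedPlace ι) vbar (mem_inducedPlace_iff ι) hvbar hne hIW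

end Datum

/-! ### §3 Non-vacuity: at every embedding there IS a strict prime carrying the published link -/

section NonVacuity

variable {W : WeierstrassCurve ℚ} [W.IsElliptic] [W.IsGloballyMinimal] {p : ℕ} [Fact p.Prime]
  {K : Type} [Field K] [NumberField K]

/-- **For every embedding `ι : K ↪ ℚ_p` and every anticyclotomic `(κ, γ)` there is a strict prime
`vbar ∋ p`, `vbar ≠ inducedPlace ι`, at which the cell's control link `ControlOnTreeGoodAt p κ vbar γ ι P`
HOLDS — published (CGLS Thm. 5.1.1) — for every `P` of infinite order, under the theorem's hypotheses
(`p > 2` good ordinary, `a_p ≢ 1 (mod p)`, `K` imaginary quadratic with `p` and every `ℓ ∣ N` split,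
`rank_ℤ E(K) = 1`, `#Ш(E/K)[p^∞] < ∞`).** The quantifier domain of the fact's `(ι, v, vbar)` binder is
non-empty at every datum of the rows it serves.
[cite: CastellaGrossiLeeSkinner2022, Thm. 5.1.1 and §2 (arXiv v2 TeX L479)] -/
theorem exists_controlOnTreeGoodAt_of_thm511 (h511 : thm511_anticyclotomicControl) (hp : 2 < p)
    (hord : GoodOrd W p) (hna : ¬ (p : ℤ) ∣ W.frobeniusTrace p - 1)
    (hK : IsImaginaryQuadratic K) (hHp : SatisfiesHeegnerHypothesis p K)
    {N : ℕ} (hN : W.conductorNorm ℤ = N) (hHN : SatisfiesHeegnerHypothesis N K)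
    (ι : K →+* ℚ_[p]) (κ : ZpExtension K p) (hκ : κ.IsAnticyclotomic)
    (γ : Field.absoluteGaloisGroup K) [Fact (κ.IsTopGenerator γ)]
    (hrk : (W.baseChange K).mordellWeilRank = 1)
    (hfin : Finite (AddCommGroup.primaryComponent (W.baseChange K).sha p)) :
    ∃ vbar : HeightOneSpectrum (𝓞 K), ((p : ℕ) : 𝓞 K) ∈ vbar.asIdeal ∧ vbar ≠ inducedPlace ι ∧
      ∀ P : (W.baseChange K).toAffine.Point, ¬ IsOfFinAddOrder P → ControlOnTreeGoodAt p κ vbar γ ι P := by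
  obtain ⟨vbar, hvbar, hne⟩ := exists_other_prime hHp (inducedPlace ι) (natCast_mem_inducedPlace ι)
  exact ⟨vbar, hvbar, hne, fun P hP ↦ controlOnTreeGoodAt_of_thm511_of_not_dvd h511 hp hord hna hK hHp
    hN hHN ι (inducedPlace ι) vbar (mem_inducedPlace_iff ι) hvbar hne κ hκ γ hrk hfin P hP⟩

end NonVacuity

end Summit.BirchSwinnertonDyer.Rank1Residual.X11b

end
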